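import Summits.BirchSwinnertonDyer.BirchSwinnertonDyer.Theorems.PrintCFramBottomClassIndexLawFiveLeKummerClassRadicalFamily
import Summits.BirchSwinnertonDyer.BirchSwinnertonDyer.Theorems.PrintCFramBottomClassIndexLawFiveLeKummerTwoCharacters
import HarnessLib

/-!
# Route `PrintCFram`, crux C2 `BottomClassIndexLawFiveLe` (stmt-BirchSwinnertonDyer-20372), line
# `eisenstein-resource-bdp-line` (registry v22; B1-sha first-order census, CASE R): **`r` INDEPENDENT EVEN EIGENCLASSES ⟹
# `r + 1` INDEPENDENT ADMISSIBLE KUMMER CHARACTERS** — the `p`-RANK form of w7 g4's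
# `KummerRadical.exists_two_independent_kummer_characters` (p684186): Herbrand's Minkowski `θ`-unit and the class radicals of an
# `𝔽_p`-independent family `x_i` (`i ∈ ι`) of `e`-eigenclasses give characters `κ_j : Γ_K →* ℤ/p`, `j ∈ Option ι`, with open
# kernels, killing the inertia above every `v ∤ p`, `ā ē⁻¹`-isotypic under `absGaloisOuterConj`, and JOINTLY INDEPENDENT:
# `∏ κ_j^{n_j} = 1 ⟹ p ∣ n_j` for every `j`
# (cell `bsd-print-cfram`, width seat `bsd-line-cfram-p1-w7` g5; helper `--supports` 20372; 0 defs, 0 facts, 0 sorry)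

HONEST FRAMING. Nothing about BSD is proved here; no summit statement is proved by this seat; no stub of the registered
skeleton is closed. Step 2/4 of the p-RANK LOWER BOUND of the B1-sha census (HOME/HANDOFF §w4 g10 FINAL, successor item (b)):
with w2 g10's reverse bridge and the family count (sequel file) these `r + 1` characters give `p^{r+1} ≤ #R_rel(ψ-line)`, hence
under (LA) `p^{r+1} ≤ #Sel_p(W/ℚ)` and `p^r ≤ #Ш(W/ℚ)[p]` on rank-one CM-ramified members — the lower twin of w4 g10's
`#Sel_p ≤ p²·t²` (p685197). Independence: a relation `∏ κ_j^{n_j} = 1` fixes `∏ β_j^{n_j}` under `Γ_K`, so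
`u^{n₀} ∏ α_i^{n_i} = y^p` in `K`; the joint independence of the class radicals (`forall_dvd_of_prod_pow_eq_unit_mul_pow`, file
`…KummerClassRadicalFamily`) gives `p ∣ n_i`, and then `u^{n₀} ∈ K^{×p}` with `u ∉ μ_K E_K^p` gives `p ∣ n₀`.

* `prod_pow_eq_pow_of_dvd` — `∏ α_i^{n_i}` is a `p`-th power when `p ∣ n_i` for all `i`;
* **`exists_independent_kummer_characters`**.
THEOREMS ONLY; no definition, no named fact, no `sorry`. References: [Washington1997] §10.2 (proof of Thm. 10.9);
[Gras2003] Ch. II §5.4 (Spiegelungssatz in `p`-ranks); [Lang1990] Ch. 13 §2 Thm. 2.1 (proof).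
-/

set_option autoImplicit false
-- `…BirchSwinnertonDyer.BirchSwinnertonDyer.Theorems…` is the problem's mandated namespace (D-0017).
set_option linter.dupNamespace false

noncomputable section

namespace Summit.BirchSwinnertonDyer.BirchSwinnertonDyer.Theorems.PrintCFram.KummerRadical

open Literature.NumberTheory.NumberFields Literature.NumberTheory.GaloisRepresentations Literature.FieldTheory.Kummer
open NumberField IsDedekindDomain Field
open scoped nonZeroDivisors Pointwise

set_option maxSynthPendingDepth 3

section Tools

variable {K : Type} [Field K] {p : ℕ}

/-- If `p ∣ n_i` for all `i` then `∏ z_i^{n_i} = (∏ z_i^{n_i / p})^p`. [folklore] -/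
theorem prod_pow_eq_pow_of_dvd {ι : Type} [Fintype ι] (z : ι → K) (n : ι → ℕ) (h : ∀ i, p ∣ n i) :
    ∏ i, z i ^ n i = (∏ i, z i ^ (n i / p)) ^ p := by
  rw [← Finset.prod_pow]
  refine Finset.prod_congr rfl fun i _ => ?_
  rw [← pow_mul, Nat.div_mul_cancel (h i)]

end Tools

/-! ## The `r + 1` characters -/

section Many

variable {K : Type} [Field K] [NumberField K] [IsCMField K] [IsGalois ℚ K] {p : ℕ} [hp : Fact p.Prime]

/-- **`r` INDEPENDENT EVEN EIGENCLASSES ⟹ `r + 1` INDEPENDENT ADMISSIBLE CHARACTERS.** `K` CM, Galois over `ℚ`, `p ∤ [K:ℚ]`,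
`ζ ∈ K` a primitive `p`-th root of unity with `σζ = ζ^{a σ}`; `θ : Gal(K/ℚ) →* ℤ_pˣ` EVEN (`θ(c) = 1`), `≠ 1`, `θ ≡ e (mod p)`;
`x : ι → Cl(𝓞 K)` a finite family of `e`-eigenclasses killed by `p` (`x_i^p = 1`, `σ·x_i = e σ • x_i`) which is
`𝔽_p`-INDEPENDENT (`∏ x_i^{n_i} = 1 ⟹ ∀ i, p ∣ n_i`; so `r = #ι ≤ rank_p e_θ(Cl K)`). Then there is a family
`κ : Option ι → (Γ_K →* ℤ/p)` of characters with open kernels, killing the inertia group of every prime of `\bar ℤ_K` above every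
`v ∤ p`, satisfying the conjugation law `κ_j(θ_γ σ) = κ_j(σ)^{a γ̄ · e γ̄⁻¹}`, and JOINTLY INDEPENDENT:
`∏_j κ_j^{n_j} = 1 ⟹ ∀ j, p ∣ n_j`. (`κ none` = Kummer character of Herbrand's Minkowski `θ̄`-unit, `κ (some i)` = of the class
radical of `x_i`.) The case `#ι = 1` is `exists_two_independent_kummer_characters`.
[cite: Washington1997, §10.2 (proof of Thm. 10.9)] [cite: Gras2003, Ch. II §5.4] [cite: Lang1990, Ch. 13 §2 Thm. 2.1 (proof)] -/
theorem exists_independent_kummer_characters (hpK : ¬ p ∣ Module.finrank ℚ K) {ζ : K} (hζ : IsPrimitiveRoot ζ p)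
    (a : (K ≃ₐ[ℚ] K) → ℕ) (ha : ∀ σ₀ : K ≃ₐ[ℚ] K, σ₀ ζ = ζ ^ a σ₀)
    (θ : (K ≃ₐ[ℚ] K) →* ℤ_[p]ˣ) (hθ1 : θ ≠ 1) (hθc : θ ((IsCMField.complexConj K).restrictScalars ℚ) = 1)
    (e : (K ≃ₐ[ℚ] K) → ℕ) (hθe : ∀ σ, ‖((θ σ : ℤ_[p]ˣ) : ℤ_[p]) - (e σ : ℤ_[p])‖ < 1)
    {ι : Type} [Fintype ι] (x : ι → ClassGroup (𝓞 K)) (hxp : ∀ i, x i ^ p = 1)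
    (hxe : ∀ (i : ι) (σ : K ≃ₐ[ℚ] K), classGroupRep ℚ K σ (Additive.ofMul (x i)) = e σ • Additive.ofMul (x i))
    (hind : ∀ n : ι → ℕ, ∏ i, x i ^ n i = 1 → ∀ i, p ∣ n i) :
    ∃ κ : Option ι → (absoluteGaloisGroup K →* Multiplicative (ZMod p)),
      (∀ j, IsOpen ((κ j).ker : Set (absoluteGaloisGroup K)) ∧
        (∀ v : HeightOneSpectrum (𝓞 K), ((p : ℕ) : 𝓞 K) ∉ v.asIdeal →
          ∀ 𝔔 ∈ v.primesAbove, ∀ g ∈ 𝔔.inertia (absoluteGaloisGroup K), κ j g = 1) ∧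
        ∀ (γ : absoluteGaloisGroup ℚ) (σ : absoluteGaloisGroup K),
          κ j (absGaloisOuterConj ℚ K γ σ) = κ j σ ^ (a (absGaloisQuot ℚ K γ) * e (absGaloisQuot ℚ K γ)⁻¹)) ∧
      ∀ n : Option ι → ℕ, ∏ j, κ j ^ n j = 1 → ∀ j, p ∣ n j := by
  classical
  haveI : NeZero p := ⟨hp.out.ne_zero⟩
  have hpr : p.Prime := hp.out
  set ζ' := algebraMap K (AlgebraicClosure K) ζ with hζ'
  have hζ'p : IsPrimitiveRoot ζ' p := hζ.map_of_injective (algebraMap K (AlgebraicClosure K)).injective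
  -- the unit radical
  obtain ⟨u, hu_eig, hu_not⟩ := UnitGalois.exists_even_eigenunit hpK θ hθ1 hθc e hθe
  have hu0 : ((u : 𝓞 K) : K) ≠ 0 := by simp
  have hu_eigK : ∀ σ₀ : K ≃ₐ[ℚ] K, ∃ y : K, σ₀ ((u : 𝓞 K) : K) = ((u : 𝓞 K) : K) ^ e σ₀ * y ^ p := by
    intro σ₀
    obtain ⟨v, hv⟩ := hu_eig σ₀
    refine ⟨((v : 𝓞 K) : K), ?_⟩
    have h := congrArg (fun z : (𝓞 K)ˣ => ((z : 𝓞 K) : K)) hv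
    simp only [UnitGalois.coe_unitsGal] at h
    rw [h]; push_cast; ring
  -- the class radicals with their ideal `p`-th roots
  have H := fun i => exists_eigenRadical_of_eigenclass_with_ideal θ e hθe (x i) (hxp i) (hxe i)
  choose α 𝔟 hα0 hα_eig hα_repr hspan hclass using H
  have hαK0 : ∀ i, ((α i : 𝓞 K) : K) ≠ 0 := fun i => RingOfIntegers.coe_ne_zero_iff.mpr (hα0 i)
  -- the radicands `R : Option ι → K`
  let R : Option ι → K := fun j => Option.elim j ((u : 𝓞 K) : K) fun i => ((α i : 𝓞 K) : K)
  have hRnone : R none = ((u : 𝓞 K) : K) := rfl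
  have hRsome : ∀ i, R (some i) = ((α i : 𝓞 K) : K) := fun i => rfl
  have hR0 : ∀ j, R j ≠ 0 := by
    rintro (_ | i)
    · exact hu0
    · exact hαK0 i
  have hReig : ∀ (j : Option ι) (σ₀ : K ≃ₐ[ℚ] K), ∃ y : K, σ₀ (R j) = R j ^ e σ₀ * y ^ p := by
    rintro (_ | i) σ₀
    · exact hu_eigK σ₀
    · exact hα_eig i σ₀
  have hRrepr : ∀ (j : Option ι) (v : HeightOneSpectrum (𝓞 K)),
      ∃ (γ : K) (a' : 𝓞 K), a' ∉ v.asIdeal ∧ R j * γ ^ p = (a' : K) := by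
    rintro (_ | i) v
    · exact ⟨1, (u : 𝓞 K), fun hmem => v.isPrime.ne_top (v.asIdeal.eq_top_of_isUnit_mem hmem (Units.isUnit u)),
        by rw [one_pow, mul_one]; rfl⟩
    · exact hα_repr i v
  -- roots and characters
  have Hβ := fun j => IsAlgClosed.exists_pow_nat_eq (algebraMap K (AlgebraicClosure K) (R j)) hpr.pos
  choose β hβ using Hβ
  have Hκ := fun j => exists_kummer_character hζ (hR0 j) (hβ j)
  choose κ hκ using Hκ
  refine ⟨κ, fun j => ⟨isOpen_ker_kummer_character hζ (hR0 j) (hβ j) (κ j) (hκ j), fun v hv 𝔔 h𝔔 g hg => ?_,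
    fun γ σ => ?_⟩, fun n hn => ?_⟩
  · obtain ⟨γ', a', ha', hrepr⟩ := hRrepr j v
    exact kummer_character_eq_one_of_mem_inertia_of_repr hζ (hβ j) (κ j) (hκ j) hv ha' hrepr h𝔔 hg
  · exact kummer_character_absGaloisOuterConj hζ a ha (hR0 j) e (hReig j) (hβ j) (κ j) (hκ j) γ σ
  · -- independence: `B = ∏ β_j^{n_j}` is fixed by `Γ_K`
    set B : AlgebraicClosure K := ∏ j, β j ^ n j with hB
    have hfix : ∀ σ : absoluteGaloisGroup K, σ • B = B := by
      intro σ
      have hrel : ∏ j, κ j σ ^ n j = 1 := by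
        have := DFunLike.congr_fun hn σ
        rwa [MonoidHom.finsetProd_apply, MonoidHom.one_apply, Finset.prod_congr rfl
          (fun j _ => MonoidHom.pow_apply (κ j) (n j) σ)] at this
      have hexp : (∑ j, (n j * ((κ j σ).toAdd : ZMod p).val : ZMod p)) = 0 := by
        have h1 := congrArg Multiplicative.toAdd hrel
        rw [toAdd_prod, toAdd_one] at h1
        simp_rw [toAdd_pow] at h1
        rw [← h1]
        refine Finset.sum_congr rfl fun j _ => ?_
        rw [ZMod.natCast_zmod_val, ← smul_eq_mul, Nat.cast_smul_eq_nsmul]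
      have hζpow : ζ' ^ (∑ j, n j * ((κ j σ).toAdd : ZMod p).val) = 1 := by
        have hdvd : p ∣ ∑ j, n j * ((κ j σ).toAdd : ZMod p).val := by
          rw [← ZMod.natCast_eq_zero_iff]; push_cast; exact hexp
        obtain ⟨m, hm⟩ := hdvd
        rw [hm, pow_mul, hζ'p.pow_eq_one, one_pow]
      rw [hB, Finset.smul_prod']
      simp_rw [smul_pow', hκ, mul_pow, ← pow_mul]
      rw [Finset.prod_mul_distrib, Finset.prod_pow_eq_pow_sum]
      simp_rw [mul_comm (((κ _ σ).toAdd : ZMod p).val) (n _)]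
      rw [hζpow, one_mul]
    obtain ⟨y, hy⟩ := (InfiniteGalois.mem_range_algebraMap_iff_fixed (k := K) B).2 (fun σ => by
      have := hfix ((absoluteGaloisGroup.toAlgEquiv K).symm σ)
      rwa [absoluteGaloisGroup.toAlgEquiv_symm_apply] at this)
    -- `∏ R_j^{n_j} = y^p` in `K`
    have hrad : ∏ j, R j ^ n j = y ^ p := by
      apply (algebraMap K (AlgebraicClosure K)).injective
      rw [map_pow, hy, hB, ← Finset.prod_pow, map_prod]
      refine Finset.prod_congr rfl fun j _ => ?_
      rw [map_pow, ← hβ j, ← pow_mul, ← pow_mul, mul_comm]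
    rw [Fintype.prod_option] at hrad
    set U : K := ((u : 𝓞 K) : K) with hU
    -- the class radicals: `∏ α_i^{n_i} = (u^{n₀})⁻¹ y^p`
    have hcoe : ((((u ^ n none)⁻¹ : (𝓞 K)ˣ) : 𝓞 K) : K) = (U ^ n none)⁻¹ := by
      apply eq_inv_of_mul_eq_one_left
      have h := congrArg (fun z : 𝓞 K => (z : K)) (Units.inv_mul (u ^ n none))
      push_cast at h
      rw [hU]
      exact h
    have hsome : ∀ i, p ∣ n (some i) := by
      refine forall_dvd_of_prod_pow_eq_unit_mul_pow hpK α 𝔟 hspan x hclass hind (u ^ n none)⁻¹ y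
        (fun i => n (some i)) ?_
      rw [hcoe, ← hRnone, eq_inv_mul_iff_mul_eq₀ (pow_ne_zero _ (hR0 none))]
      exact hrad
    rintro (_ | i)
    · -- the unit: `u^{n₀} = (y / z)^p`
      by_contra hi
      set z : K := ∏ i, R (some i) ^ (n (some i) / p) with hz
      have hzp : ∏ i, R (some i) ^ n (some i) = z ^ p := prod_pow_eq_pow_of_dvd _ _ hsome
      have hz0 : z ≠ 0 := Finset.prod_ne_zero_iff.mpr fun i _ => pow_ne_zero _ (hR0 (some i))
      have hUp : U ^ n none = (y / z) ^ p := by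
        rw [div_pow, eq_div_iff (pow_ne_zero _ hz0), ← hzp]
        exact hrad
      obtain ⟨m, hm⟩ := exists_mul_mod_eq_one' hi
      have him : n none * m = p * (n none * m / p) + 1 := by
        have := Nat.div_add_mod (n none * m) p
        rw [hm] at this
        omega
      set q : ℕ := n none * m / p with hq
      -- `w₀ = (y/z)^m / U^q` has `w₀^p = U`
      set w₀ : K := (y / z) ^ m / U ^ q with hw₀
      have hU0 : U ≠ 0 := hR0 none
      have hw₀p : w₀ ^ p = ((u : 𝓞 K) : K) := by
        have key : ((y / z) ^ m) ^ p = U ^ (p * q + 1) := by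
          rw [← pow_mul, mul_comm m p, pow_mul, ← hUp, ← pow_mul, him]
        rw [hw₀, div_pow, key, ← hU, pow_succ, ← pow_mul, mul_comm q p]
        field_simp
      obtain ⟨w, hw⟩ := exists_unit_pow_eq hw₀p
      exact hu_not 1 (Subgroup.one_mem _) w (by rw [one_mul]; exact hw)
    · exact hsome i

end Many

end Summit.BirchSwinnertonDyer.BirchSwinnertonDyer.Theorems.PrintCFram.KummerRadical

end
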